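import Summits.PneNP.PneNP.Theorems.ChebyshevTracialDesignJuntaRemainderRung
import HarnessLib

/-!
# Cell pnp-psdrank, route `ChebyshevTracialDesign`: (CG_1') FOR JUNTA MASKS IN SPARSE DIRECTIONS BEYOND THE DESIGN DEGREE — the per-matching exact
# cell of bricks 103/109 (`|J| + 2 ≤ D`) continues to junta size `a = |J| + 2|supp v| = O(D)` with the Newton remainder
# `Σ_M (Q^f_M(v_M))₊ ≤ B_v·C(T,D+1)·Λ_f s²·8^a·C(a,D+1)(D+1)!/N^{D+1}` (crux `TracialDecayExp20`, stmt-PneNP-19878)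

Brick 112 (prover g20; MEMO-23 §2(c); bricks 110b/110c applied to (CG_1')). The (CG_1') pair-containment form of a mask `f` at a matching `M` in
direction `v` is `Q^f_M(v) = Σ_U W(U,M)·f(U)·C_v(U)²`, `C_v(U) = Σ_p v_p x_p x_{π_M p}` (bricks 98–109). For a `J`-junta mask `f` and a direction `v`
supported on `S`, the integrand `f·C_v²` is a junta on `J ∪ S ∪ π_M(S)` (`containment_congr_of_support`), of size `≤ |J| + 2|S|`, bounded by `Λ_f|S|²`
(`abs_containment_le`), so brick 110c's ONE-MATCHING-AT-A-TIME junta pricing applies: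
* **`containment_junta_le_single`** — exact design `(n,t,T,D,B_v,C,w)`, `0 ≤ f ≤ Λ_f` depending only on `U ∩ J`, `v` supported on `S` with `|v_p| ≤ 1`,
  `|J| + 2|S| ≤ a` with `2a ≤ t+2`, `2a + t ≤ n+2`, `4a ≤ n`: for EVERY matching `M`,
  `Q^f_M(v) ≤ |PM|⁻¹·B_v·C(T,D+1)·Λ_f|S|²·8^a·C(a,D+1)(D+1)!/N^{D+1}` (`N = n/2`; zero for `a ≤ D`).
* **`sum_posPart_containment_junta_le`** — with MATCHING-ADAPTED sparse directions `v_M` (supports `S_M`, `|S_M| ≤ s`, `|v_M| ≤ 1`) and `|J| + 2s ≤ a`: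
  `Σ_M (Q^f_M(v_M))₊ ≤ B_v·C(T,D+1)·Λ_f s²·8^a·C(a,D+1)(D+1)!/N^{D+1}`. In the balanced Chebyshev regime (`B_v = 20`, `T ≍ 4√n`, `D = dq n ≍ n^{1/4}`)
  this is `≈ 20Λ_f s²·8^a(8a/√n)^{dq n+1}`: the (CG_1') defect of junta masks in junta directions of total size `a = O(dq n)` is `n^{−(dq n+1)/4+O(a/ln n)}`,
  summed over ALL matchings and with the sup over the admissible directions taken matching by matching.
READING (MEMO-23 §2(c)): inside (CG_1') the priced cells are now — sign-coherent cone (102), level direction (103), low-degree SOS masks per `M` (103),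
fixed directions on `M`-average (104/105), nonneg juntas `|J|+2 ≤ D` per `M` in every direction (109), and juntas × sparse adapted directions of total
size `O(D)` per `M` up to a super-polynomially small remainder (this file). Dense directions for junta masks of size `> D − 2`, and non-junta masks, remain.
[cite: Rothvoss2017, §2 (PDF p. 6)] [cite: Grigoriev2001, Lemma 1.4 (PDF p. 8)] [cite: Agarwal2000DifferenceEquations, Remark 1.8.1 (1.8.8)]
[cite: GriblingDelaatLaurent2019, §5]
Stature: support/instrument (kernel lane, no defs, axioms standard). WHAT THIS IS NOT: nothing on dense directions or non-junta masks, no proof or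
refutation of `TracialDecayExp20`, nothing on psd rank of P_PM(K_n), no P-vs-NP content. Supports stmt-PneNP-19878.
-/

set_option linter.dupNamespace false -- `Summit.PneNP.PneNP.…`: summit = sub-problem (D-0017)

noncomputable section

namespace Summit.PneNP.PneNP.Theorems.ChebyshevTracialDesignJuntaContainmentRemainder

open Finset Matrix Literature.Barriers.PneNP Literature.Combinatorics.Optimization
open Summit.PneNP.PneNP.Theorems.ChebyshevTracialDesignJuntaRemainderRung (sum_levelWeight_junta_le_single)

variable {n : ℕ}

/-! ### §1 The containment form in a sparse direction is a junta -/

/-- **The containment form in a direction supported on `S` is a junta on `S ∪ π_M(S)`**: `C_v(U) = Σ_p v_p x_p x_{π_M p}` takes the same value on two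
cuts with the same trace on `S ∪ π_M(S)` whenever `v` vanishes off `S`. [folklore] -/
theorem containment_congr_of_support (S : Finset (Fin n)) (M : PMatch n) (v : Fin n → ℝ) (hv : ∀ p, p ∉ S → v p = 0) {U U' : OddSet n}
    (h : U.1 ∩ (S ∪ S.image (M.2.partner)) = U'.1 ∩ (S ∪ S.image (M.2.partner))) :
    ∑ p, v p * ((if p ∈ U.1 then (1 : ℝ) else 0) * (if M.2.partner p ∈ U.1 then (1 : ℝ) else 0)) =
      ∑ p, v p * ((if p ∈ U'.1 then (1 : ℝ) else 0) * (if M.2.partner p ∈ U'.1 then (1 : ℝ) else 0)) := by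
  classical
  set A : Finset (Fin n) := S ∪ S.image (M.2.partner) with hA
  have hmem : ∀ z ∈ A, (z ∈ U.1 ↔ z ∈ U'.1) := fun z hz => by
    constructor
    · intro hzU
      have : z ∈ U.1 ∩ A := mem_inter.2 ⟨hzU, hz⟩
      rw [h] at this; exact (mem_inter.1 this).1
    · intro hzU'
      have : z ∈ U'.1 ∩ A := mem_inter.2 ⟨hzU', hz⟩
      rw [← h] at this; exact (mem_inter.1 this).1
  refine sum_congr rfl fun p _ => ?_
  by_cases hp : p ∈ S
  · have hpA : p ∈ A := mem_union_left _ hp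
    have hπA : M.2.partner p ∈ A := mem_union_right _ (mem_image_of_mem _ hp)
    simp only [hmem p hpA, hmem _ hπA]
  · rw [hv p hp, zero_mul, zero_mul]

/-- `|C_v(U)| ≤ |S|` for `v` supported on `S` with `|v_p| ≤ 1`. [folklore] -/
theorem abs_containment_le (S : Finset (Fin n)) (M : PMatch n) (v : Fin n → ℝ) (hv : ∀ p, p ∉ S → v p = 0)
    (hv1 : ∀ p, |v p| ≤ 1) (U : OddSet n) :
    |∑ p, v p * ((if p ∈ U.1 then (1 : ℝ) else 0) * (if M.2.partner p ∈ U.1 then (1 : ℝ) else 0))| ≤ S.card := by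
  classical
  have hsupp : ∑ p, v p * ((if p ∈ U.1 then (1 : ℝ) else 0) * (if M.2.partner p ∈ U.1 then (1 : ℝ) else 0)) =
      ∑ p ∈ S, v p * ((if p ∈ U.1 then (1 : ℝ) else 0) * (if M.2.partner p ∈ U.1 then (1 : ℝ) else 0)) := by
    rw [← sum_subset (subset_univ S)]
    intro p _ hp
    rw [hv p hp, zero_mul]
  rw [hsupp]
  calc |∑ p ∈ S, v p * ((if p ∈ U.1 then (1 : ℝ) else 0) * (if M.2.partner p ∈ U.1 then (1 : ℝ) else 0))|
      ≤ ∑ p ∈ S, |v p * ((if p ∈ U.1 then (1 : ℝ) else 0) * (if M.2.partner p ∈ U.1 then (1 : ℝ) else 0))| := abs_sum_le_sum_abs _ _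
    _ ≤ ∑ _p ∈ S, (1 : ℝ) := sum_le_sum fun p _ => by
        rw [abs_mul]
        have h2 : |(if p ∈ U.1 then (1 : ℝ) else 0) * (if M.2.partner p ∈ U.1 then (1 : ℝ) else 0)| ≤ 1 := by
          split_ifs <;> simp
        calc |v p| * |(if p ∈ U.1 then (1 : ℝ) else 0) * (if M.2.partner p ∈ U.1 then (1 : ℝ) else 0)| ≤ 1 * 1 :=
              mul_le_mul (hv1 p) h2 (abs_nonneg _) zero_le_one
          _ = 1 := one_mul 1
    _ = S.card := by rw [sum_const, nsmul_eq_mul, mul_one]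

/-! ### §2 (CG_1') for junta masks in sparse directions, beyond the design degree -/

/-- **JUNTA MASKS IN SPARSE DIRECTIONS ARE PRICED PER MATCHING BEYOND THE DESIGN DEGREE.** For an exact design `(n,t,T,D,B_v,C,w)`, a perfect
matching `M`, a mask `0 ≤ f ≤ Λ_f` on the odd cuts depending only on `U ∩ J`, a direction `v` supported on `S` with `|v_p| ≤ 1`, and `a` with
`|J| + 2|S| ≤ a`, `2a ≤ t+2`, `2a + t ≤ n+2`, `4a ≤ n`:
`Q^f_M(v) = Σ_U W(U,M)·f(U)·C_v(U)² ≤ |PM|⁻¹·B_v·C(T,D+1)·(Λ_f|S|²)·8^a·C(a,D+1)·(D+1)!/N^{D+1}` (`N = n/2`; bricks 110b/110c applied to the junta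
`f·C_v²` on `J ∪ S ∪ π_M(S)`). Zero for `a ≤ D`: the exact cell of bricks 103/109. [cite: Rothvoss2017, §2 (PDF p. 6)] [cite: Grigoriev2001, Lemma 1.4 (PDF p. 8)]
[cite: Agarwal2000DifferenceEquations, Remark 1.8.1 (1.8.8)] -/
theorem containment_junta_le_single {t T D : ℕ} {Bv : ℝ} {C : Finset ℕ} {w : ℕ → ℝ} (hdes : IsExactDesign n t T D Bv C w)
    (M : PMatch n) (J : Finset (Fin n)) (f : OddSet n → ℝ) (hf : ∀ U U' : OddSet n, U.1 ∩ J = U'.1 ∩ J → f U = f U')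
    {Λf : ℝ} (hf0 : ∀ U, 0 ≤ f U) (hfΛ : ∀ U, f U ≤ Λf)
    (S : Finset (Fin n)) (v : Fin n → ℝ) (hv : ∀ p, p ∉ S → v p = 0) (hv1 : ∀ p, |v p| ≤ 1)
    (a : ℕ) (ha : J.card + 2 * S.card ≤ a) (hat : 2 * a ≤ t + 2) (han : 2 * a + t ≤ n + 2) (ha4 : 4 * a ≤ n) :
    ∑ U : OddSet n, levelWeight n t C w U M *
        (f U * (∑ p, v p * ((if p ∈ U.1 then (1 : ℝ) else 0) * (if M.2.partner p ∈ U.1 then (1 : ℝ) else 0))) ^ 2) ≤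
      (Fintype.card (PMatch n) : ℝ)⁻¹ * (Bv * ((T.choose (D + 1) : ℕ) : ℝ) * ((Λf * (S.card : ℝ) ^ 2) * (8 : ℝ) ^ a *
        (((a.choose (D + 1) : ℕ) : ℝ) * ((D + 1).factorial : ℝ) / (((n / 2 : ℕ) : ℝ)) ^ (D + 1)))) := by
  classical
  set A : Finset (Fin n) := J ∪ (S ∪ S.image (M.2.partner)) with hA
  have hAcard : A.card ≤ a := by
    calc A.card ≤ J.card + (S ∪ S.image (M.2.partner)).card := card_union_le _ _
      _ ≤ J.card + (S.card + (S.image (M.2.partner)).card) := Nat.add_le_add_left (card_union_le _ _) _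
      _ ≤ J.card + (S.card + S.card) := by have := card_image_le (s := S) (f := M.2.partner); omega
      _ ≤ a := by omega
  set g : OddSet n → ℝ := fun U => f U *
    (∑ p, v p * ((if p ∈ U.1 then (1 : ℝ) else 0) * (if M.2.partner p ∈ U.1 then (1 : ℝ) else 0))) ^ 2 with hg
  have hgdep : ∀ U U' : OddSet n, U.1 ∩ A = U'.1 ∩ A → g U = g U' := by
    intro U U' hUU'
    have hJ : U.1 ∩ J = U'.1 ∩ J := by
      have := congrArg (fun X => X ∩ J) hUU'
      simp only [inter_assoc] at this
      rwa [show A ∩ J = J from inter_eq_right.2 (fun x hx => mem_union_left _ hx)] at this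
    have hS : U.1 ∩ (S ∪ S.image (M.2.partner)) = U'.1 ∩ (S ∪ S.image (M.2.partner)) := by
      have := congrArg (fun X => X ∩ (S ∪ S.image (M.2.partner))) hUU'
      simp only [inter_assoc] at this
      rwa [show A ∩ (S ∪ S.image (M.2.partner)) = S ∪ S.image (M.2.partner) from inter_eq_right.2 subset_union_right] at this
    rw [hg]; dsimp only
    rw [hf U U' hJ, containment_congr_of_support S M v hv hS]
  have hg0 : ∀ U, 0 ≤ g U := fun U => by rw [hg]; exact mul_nonneg (hf0 U) (sq_nonneg _)
  have hΛf : 0 ≤ Λf := by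
    -- `OddSet n` is nonempty (the design has a nonempty level class)
    obtain ⟨c₀, hc₀⟩ := nonempty_of_exact hdes.exact
    obtain ⟨q, _⟩ := (hdes.2.2.2.1 c₀ hc₀).2.2.2
    exact (hf0 q.1).trans (hfΛ q.1)
  have hgΛ : ∀ U, g U ≤ Λf * (S.card : ℝ) ^ 2 := fun U => by
    rw [hg]; dsimp only
    have h1 := abs_containment_le S M v hv hv1 U
    have h2 : (∑ p, v p * ((if p ∈ U.1 then (1 : ℝ) else 0) * (if M.2.partner p ∈ U.1 then (1 : ℝ) else 0))) ^ 2 ≤ (S.card : ℝ) ^ 2 := by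
      rw [← sq_abs]
      exact pow_le_pow_left₀ (abs_nonneg _) h1 2
    exact mul_le_mul (hfΛ U) h2 (sq_nonneg _) hΛf
  have h := sum_levelWeight_junta_le_single hdes M A (by omega) (by omega) (by omega) g hgdep hg0 hgΛ
  refine h.trans ?_
  -- monotonicity of the constant in the junta size
  have hB : 0 ≤ Bv := (sum_nonneg fun c _ => abs_nonneg (w c)).trans hdes.2.2.2.2.2.2
  have h8 : (8 : ℝ) ^ A.card ≤ (8 : ℝ) ^ a := pow_le_pow_right₀ (by norm_num) hAcard
  have hch : ((A.card.choose (D + 1) : ℕ) : ℝ) ≤ ((a.choose (D + 1) : ℕ) : ℝ) := Nat.cast_le.2 (Nat.choose_le_choose _ hAcard)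
  have hS2 : 0 ≤ Λf * (S.card : ℝ) ^ 2 := by positivity
  refine mul_le_mul_of_nonneg_left (mul_le_mul_of_nonneg_left ?_ (by positivity)) (inv_nonneg.2 (Nat.cast_nonneg _))
  calc Λf * (S.card : ℝ) ^ 2 * (8 : ℝ) ^ A.card *
        (((A.card.choose (D + 1) : ℕ) : ℝ) * ((D + 1).factorial : ℝ) / (((n / 2 : ℕ) : ℝ)) ^ (D + 1))
      ≤ Λf * (S.card : ℝ) ^ 2 * (8 : ℝ) ^ a *
        (((a.choose (D + 1) : ℕ) : ℝ) * ((D + 1).factorial : ℝ) / (((n / 2 : ℕ) : ℝ)) ^ (D + 1)) := by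
        refine mul_le_mul (mul_le_mul_of_nonneg_left h8 hS2) ?_ (by positivity) (by positivity)
        exact div_le_div_of_nonneg_right (mul_le_mul_of_nonneg_right hch (by positivity)) (by positivity)

/-- **(CG_1') FOR JUNTA MASKS IN SPARSE (MATCHING-ADAPTED) DIRECTIONS, SUMMED OVER THE MATCHINGS.** With `f` a nonnegative `J`-junta mask
`≤ Λ_f` and, for every matching `M`, a direction `v_M` supported on a set `S_M` with `|S_M| ≤ s` and `|v_M| ≤ 1`, and `a ≥ |J| + 2s` in the
admissible range: `Σ_M (Q^f_M(v_M))₊ ≤ B_v·C(T,D+1)·Λ_f·s²·8^a·C(a,D+1)(D+1)!/N^{D+1}` — the per-matching exact cell of bricks 103/109 (`a ≤ D − 2`)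
continues to `a = O(D)` with a remainder that is super-polynomially small in the balanced Chebyshev regime (`≈ 20Λ_f s²·8^a(8a/√n)^{dq n+1}`).
[cite: Rothvoss2017, §2 (PDF p. 6)] [cite: Grigoriev2001, Lemma 1.4 (PDF p. 8)] [cite: Agarwal2000DifferenceEquations, Remark 1.8.1 (1.8.8)] -/
theorem sum_posPart_containment_junta_le {t T D : ℕ} {Bv : ℝ} {C : Finset ℕ} {w : ℕ → ℝ} (hdes : IsExactDesign n t T D Bv C w)
    (J : Finset (Fin n)) (f : OddSet n → ℝ) (hf : ∀ U U' : OddSet n, U.1 ∩ J = U'.1 ∩ J → f U = f U')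
    {Λf : ℝ} (hf0 : ∀ U, 0 ≤ f U) (hfΛ : ∀ U, f U ≤ Λf)
    (S : PMatch n → Finset (Fin n)) {s : ℕ} (hS : ∀ M, (S M).card ≤ s)
    (v : PMatch n → Fin n → ℝ) (hv : ∀ M p, p ∉ S M → v M p = 0) (hv1 : ∀ M p, |v M p| ≤ 1)
    (a : ℕ) (ha : J.card + 2 * s ≤ a) (hat : 2 * a ≤ t + 2) (han : 2 * a + t ≤ n + 2) (ha4 : 4 * a ≤ n) :
    ∑ M : PMatch n, max (∑ U : OddSet n, levelWeight n t C w U M *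
        (f U * (∑ p, v M p * ((if p ∈ U.1 then (1 : ℝ) else 0) * (if M.2.partner p ∈ U.1 then (1 : ℝ) else 0))) ^ 2)) 0 ≤
      Bv * ((T.choose (D + 1) : ℕ) : ℝ) * ((Λf * (s : ℝ) ^ 2) * (8 : ℝ) ^ a *
        (((a.choose (D + 1) : ℕ) : ℝ) * ((D + 1).factorial : ℝ) / (((n / 2 : ℕ) : ℝ)) ^ (D + 1))) := by
  have hB : 0 ≤ Bv := (sum_nonneg fun c _ => abs_nonneg (w c)).trans hdes.2.2.2.2.2.2
  have hΛf : 0 ≤ Λf := by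
    obtain ⟨c₀, hc₀⟩ := nonempty_of_exact hdes.exact
    obtain ⟨q, _⟩ := (hdes.2.2.2.1 c₀ hc₀).2.2.2
    exact (hf0 q.1).trans (hfΛ q.1)
  set X : ℝ := Bv * ((T.choose (D + 1) : ℕ) : ℝ) * ((Λf * (s : ℝ) ^ 2) * (8 : ℝ) ^ a *
    (((a.choose (D + 1) : ℕ) : ℝ) * ((D + 1).factorial : ℝ) / (((n / 2 : ℕ) : ℝ)) ^ (D + 1))) with hX
  have hX0 : 0 ≤ X := by rw [hX]; positivity
  have hper : ∀ M : PMatch n, max (∑ U : OddSet n, levelWeight n t C w U M *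
      (f U * (∑ p, v M p * ((if p ∈ U.1 then (1 : ℝ) else 0) * (if M.2.partner p ∈ U.1 then (1 : ℝ) else 0))) ^ 2)) 0 ≤
      (Fintype.card (PMatch n) : ℝ)⁻¹ * X := by
    intro M
    refine max_le ?_ (by positivity)
    have h := containment_junta_le_single hdes M J f hf hf0 hfΛ (S M) (v M) (hv M) (hv1 M) a
      (by have := hS M; omega) hat han ha4
    refine h.trans (mul_le_mul_of_nonneg_left ?_ (inv_nonneg.2 (Nat.cast_nonneg _)))
    rw [hX]
    have hsS : ((S M).card : ℝ) ^ 2 ≤ (s : ℝ) ^ 2 := pow_le_pow_left₀ (Nat.cast_nonneg _) (Nat.cast_le.2 (hS M)) 2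
    refine mul_le_mul_of_nonneg_left ?_ (by positivity)
    refine mul_le_mul_of_nonneg_right (mul_le_mul_of_nonneg_right ?_ (by positivity)) (by positivity)
    exact mul_le_mul_of_nonneg_left hsS hΛf
  calc ∑ M : PMatch n, max (∑ U : OddSet n, levelWeight n t C w U M *
        (f U * (∑ p, v M p * ((if p ∈ U.1 then (1 : ℝ) else 0) * (if M.2.partner p ∈ U.1 then (1 : ℝ) else 0))) ^ 2)) 0
      ≤ ∑ _M : PMatch n, (Fintype.card (PMatch n) : ℝ)⁻¹ * X := sum_le_sum fun M _ => hper M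
    _ ≤ X := by
        rw [sum_const, card_univ, nsmul_eq_mul]
        rcases eq_or_ne (Fintype.card (PMatch n) : ℝ) 0 with h0 | h0
        · rw [h0]; simp [hX0]
        · rw [← mul_assoc, mul_inv_cancel₀ h0, one_mul]

end Summit.PneNP.PneNP.Theorems.ChebyshevTracialDesignJuntaContainmentRemainder
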